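import Summits.QuantumFields.BalabanUV.T4Continuum.Support.NE7LawLevelOldLayers

/-!
# NE7, ROAD P4 (law-level): second moments of DOMINATED COUNTS (coherent branch + diagonal branch)

(Cell `pub-balaban`, sub-cell `t4`, binder row NE7 = node U5, co-owner #4 `b2b-balaban-t4-ne7-p4`, gen 5; skeleton
`HOME/t4/skeletons/NE7-t4-ne7-p4.md` §2 NODE Q.old (v1.11) and `HOME/t4/b2b-balaban-t4-ne7-p4/g5/BOOKING-H-NE7-P4.md`
§3.  Imports the road's `NE7LawLevelOldLayers` only for its namespace and integrability helpers.)

HONEST FRAMING (T4-DAG PAGE 1).  Rung (B)+1 on ONE FIXED finite four-torus, CONDITIONAL on `BetaPertH` and the nine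
spine estimates (0/9 proved); NOT infinite volume, NOT a mass gap, NOT the Clay problem.  NE7 is NOT PRINTED and NOT
proved here; every theorem below is [folklore] finite algebra + integration over plain data, sorry-free; no statement
of the audited series ([Balaban1989LargeFieldI] (0.1) in particular) is asserted or used; NOT summit progress.

WHAT THIS FILE DOES.  In the LABELLED booking of NODE Q.old (`NE7LawLevelLabelled`, BOOKING-H §1) the conditional
expectations given the label are sums over the label's large-field components, and the layer budgets integrate
SQUARES OF SUCH SUMS against the law of the label.  With `ξ i ∈ [0,1]` (DICTIONARY: the indicator that the candidate
component ∕ cube `i` belongs to the label's large-field set at the relevant level) and nonnegative weights `a i`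
(DICTIONARY: the per-component oscillation ∕ Lipschitz entry), PRODUCT DOMINATION AT ORDERS ONE AND TWO —
`∫ ξ i ≤ q i`, `∫ ξ i·ξ j ≤ q i·q j` for `i ≠ j` (DICTIONARY: the (0.1)-TYPE weight `e^{−p₀(g)}` per cube, B15
p. 175, and its product form for distinct regions — row NE1′-P2's (MI-F2′) `T4PathwiseCoupling` by name; PRINTED-1RUN
shape ∕ [dict], NOT asserted here) — gives (`integral_sq_sum_le_of_dominated`)
  `∫ (Σ_i a i·ξ i)² ≤ (Σ_i a i·q i)² + Σ_i (a i)²·q i`: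
the COHERENT branch `(Σ a q)²` (the skeleton's vLayer line, v1.7–v1.10) plus the DIAGONAL branch `Σ a² q` (added in
v1.11; it dominates exactly when the expected count `Σ q` is below one).  The «diagonal versus squares-of-sums»
question of the synth's Q17 is, in the labelled booking, the two terms of this one inequality.  §2 gives the form
with bounded RANDOM coefficients (`|c i ω| ≤ a i`), which is how the budgets use it.  Nothing here is an estimate about
Bałaban's chain.
-/

noncomputable section

open MeasureTheory Finset
open scoped BigOperators

namespace Summit.QuantumFields.BalabanUV.T4Continuum.NE7LawLevel

open Literature.MathematicalPhysics.QuantumFieldTheory.Balaban1983to89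
open Literature.MathematicalPhysics.QuantumFieldTheory.Balaban1983to89.T4MeanChannel

variable {Ω : Type*} {mΩ : MeasurableSpace Ω} {μ : Measure Ω} {ι : Type*}

/-! ## §1 Deterministic nonnegative weights -/

section Deterministic

/-- The square of a weighted sum of `[0,1]`-valued variables, expanded and bounded termwise:
`(Σ a i ξ i)² ≤ Σ_i Σ_j a i a j ξ i ξ j` is an identity; we record the expansion. [folklore] -/
theorem sq_sum_mul_eq (s : Finset ι) (a : ι → ℝ) (x : ι → ℝ) :
    (∑ i ∈ s, a i * x i) ^ 2 = ∑ i ∈ s, ∑ j ∈ s, (a i * a j) * (x i * x j) := by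
  rw [sq, sum_mul_sum]
  exact sum_congr rfl fun i _ => sum_congr rfl fun j _ => by ring

/-- **SECOND MOMENT OF A DOMINATED COUNT.**  For `[0,1]`-valued measurable `ξ i`, nonnegative weights `a i`, and
product domination at orders one and two (`∫ ξ i ≤ q i`, `∫ ξ i ξ j ≤ q i q j` for `i ≠ j`):
`∫ (Σ_i a i ξ i)² ≤ (Σ_i a i q i)² + Σ_i (a i)² q i` — coherent branch plus diagonal branch. [folklore] -/
theorem integral_sq_sum_le_of_dominated [IsFiniteMeasure μ] (s : Finset ι) {ξ : ι → Ω → ℝ} {a q : ι → ℝ}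
    (hξm : ∀ i ∈ s, Measurable (ξ i)) (hξ0 : ∀ i ∈ s, ∀ ω, 0 ≤ ξ i ω) (hξ1 : ∀ i ∈ s, ∀ ω, ξ i ω ≤ 1)
    (ha : ∀ i ∈ s, 0 ≤ a i) (h1 : ∀ i ∈ s, ∫ ω, ξ i ω ∂μ ≤ q i)
    (h2 : ∀ i ∈ s, ∀ j ∈ s, i ≠ j → ∫ ω, ξ i ω * ξ j ω ∂μ ≤ q i * q j) :
    ∫ ω, (∑ i ∈ s, a i * ξ i ω) ^ 2 ∂μ ≤ (∑ i ∈ s, a i * q i) ^ 2 + ∑ i ∈ s, a i ^ 2 * q i := by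
  classical
  -- integrability of the products (bounded by 1 on a finite measure space)
  have hbd : ∀ i ∈ s, ∀ ω, |ξ i ω| ≤ 1 := fun i hi ω => abs_le.mpr ⟨by linarith [hξ0 i hi ω], hξ1 i hi ω⟩
  have hI : ∀ i ∈ s, ∀ j ∈ s, Integrable (fun ω => ξ i ω * ξ j ω) μ := fun i hi j hj =>
    integrable_mul_of_abs_le_left (hξm i hi).aestronglyMeasurable (hbd i hi)
      (integrable_of_ae_abs_le (hξm j hj).aestronglyMeasurable (ae_of_all μ (hbd j hj)))
  have hq : ∀ i ∈ s, 0 ≤ q i := fun i hi => (integral_nonneg (hξ0 i hi)).trans (h1 i hi)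
  -- the termwise bound `∫ ξ i ξ j ≤ M i j := q i q j + [i = j] q i`
  have hM : ∀ i ∈ s, ∀ j ∈ s, ∫ ω, ξ i ω * ξ j ω ∂μ ≤ q i * q j + if i = j then q i else 0 := by
    intro i hi j hj
    by_cases hij : i = j
    · subst hij
      rw [if_pos rfl]
      have hsq : ∫ ω, ξ i ω * ξ i ω ∂μ ≤ ∫ ω, ξ i ω ∂μ :=
        integral_mono (hI i hi i hi) (integrable_of_ae_abs_le (hξm i hi).aestronglyMeasurable
          (ae_of_all μ (hbd i hi))) fun ω => by
            have := mul_le_mul_of_nonneg_left (hξ1 i hi ω) (hξ0 i hi ω)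
            simpa using this
      nlinarith [hsq, h1 i hi, hq i hi]
    · rw [if_neg hij, add_zero]; exact h2 i hi j hj hij
  -- expand, integrate, bound termwise
  have hexp : ∀ ω, (∑ i ∈ s, a i * ξ i ω) ^ 2 = ∑ i ∈ s, ∑ j ∈ s, (a i * a j) * (ξ i ω * ξ j ω) :=
    fun ω => sq_sum_mul_eq s a (fun i => ξ i ω)
  have hIij : ∀ i ∈ s, ∀ j ∈ s, Integrable (fun ω => (a i * a j) * (ξ i ω * ξ j ω)) μ :=
    fun i hi j hj => (hI i hi j hj).const_mul _
  calc ∫ ω, (∑ i ∈ s, a i * ξ i ω) ^ 2 ∂μ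
        = ∫ ω, ∑ i ∈ s, ∑ j ∈ s, (a i * a j) * (ξ i ω * ξ j ω) ∂μ := by simp_rw [hexp]
    _ = ∑ i ∈ s, ∑ j ∈ s, (a i * a j) * ∫ ω, ξ i ω * ξ j ω ∂μ := by
        rw [integral_finsetSum _ fun i hi => integrable_finsetSum _ fun j hj => hIij i hi j hj]
        refine sum_congr rfl fun i hi => ?_
        rw [integral_finsetSum _ fun j hj => hIij i hi j hj]
        exact sum_congr rfl fun j _ => integral_const_mul _ _
    _ ≤ ∑ i ∈ s, ∑ j ∈ s, (a i * a j) * (q i * q j + if i = j then q i else 0) :=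
        sum_le_sum fun i hi => sum_le_sum fun j hj =>
          mul_le_mul_of_nonneg_left (hM i hi j hj) (mul_nonneg (ha i hi) (ha j hj))
    _ = ∑ i ∈ s, ∑ j ∈ s, (a i * q i) * (a j * q j) + ∑ i ∈ s, a i ^ 2 * q i := by
        rw [← sum_add_distrib]
        refine sum_congr rfl fun i hi => ?_
        have hsplit : ∀ j ∈ s, (a i * a j) * (q i * q j + if i = j then q i else 0) =
            (a i * q i) * (a j * q j) + if i = j then a i ^ 2 * q i else 0 := fun j _ => by
          by_cases hij : i = j
          · subst hij; rw [if_pos rfl, if_pos rfl]; ring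
          · rw [if_neg hij, if_neg hij]; ring
        rw [sum_congr rfl hsplit, sum_add_distrib, sum_ite_eq, if_pos hi]
    _ = (∑ i ∈ s, a i * q i) ^ 2 + ∑ i ∈ s, a i ^ 2 * q i := by rw [sq, sum_mul_sum]

end Deterministic

/-! ## §2 Bounded random coefficients -/

section Random

/-- **THE FORM THE BUDGETS USE.**  If the coefficients are random but bounded, `|c i ω| ≤ a i`, the same bound holds:
`∫ (Σ_i c i ξ i)² ≤ (Σ_i a i q i)² + Σ_i (a i)² q i` (since `ξ ≥ 0`, `|Σ c ξ| ≤ Σ a ξ` pointwise; no measurability of `c` is needed).  DICTIONARY: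
`c i` = the contribution of component `i` (a bounded functional of the state), `ξ i` = its membership in the label's
large-field set, `a i` = its sup ∕ oscillation budget, `q i` = the (0.1)-type weight. [folklore] -/
theorem integral_sq_sum_le_of_dominated_random [IsFiniteMeasure μ] (s : Finset ι) {ξ c : ι → Ω → ℝ} {a q : ι → ℝ}
    (hξm : ∀ i ∈ s, Measurable (ξ i)) (hξ0 : ∀ i ∈ s, ∀ ω, 0 ≤ ξ i ω) (hξ1 : ∀ i ∈ s, ∀ ω, ξ i ω ≤ 1)
    (ha : ∀ i ∈ s, 0 ≤ a i) (hca : ∀ i ∈ s, ∀ ω, |c i ω| ≤ a i)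
    (h1 : ∀ i ∈ s, ∫ ω, ξ i ω ∂μ ≤ q i)
    (h2 : ∀ i ∈ s, ∀ j ∈ s, i ≠ j → ∫ ω, ξ i ω * ξ j ω ∂μ ≤ q i * q j) :
    ∫ ω, (∑ i ∈ s, c i ω * ξ i ω) ^ 2 ∂μ ≤ (∑ i ∈ s, a i * q i) ^ 2 + ∑ i ∈ s, a i ^ 2 * q i := by
  -- pointwise domination `(Σ c ξ)² ≤ (Σ a ξ)²`
  have hpt : ∀ ω, (∑ i ∈ s, c i ω * ξ i ω) ^ 2 ≤ (∑ i ∈ s, a i * ξ i ω) ^ 2 := fun ω => by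
    have hle : |∑ i ∈ s, c i ω * ξ i ω| ≤ ∑ i ∈ s, a i * ξ i ω :=
      (abs_sum_le_sum_abs _ _).trans (sum_le_sum fun i hi => by
        rw [abs_mul, abs_of_nonneg (hξ0 i hi ω)]
        exact mul_le_mul_of_nonneg_right (hca i hi ω) (hξ0 i hi ω))
    have h0 : 0 ≤ ∑ i ∈ s, a i * ξ i ω := sum_nonneg fun i hi => mul_nonneg (ha i hi) (hξ0 i hi ω)
    calc (∑ i ∈ s, c i ω * ξ i ω) ^ 2 = |∑ i ∈ s, c i ω * ξ i ω| ^ 2 := (sq_abs _).symm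
      _ ≤ (∑ i ∈ s, a i * ξ i ω) ^ 2 := pow_le_pow_left₀ (abs_nonneg _) hle 2
  -- integrability of the dominating square (bounded by `(Σ a)²`)
  have hbd : ∀ ω, |∑ i ∈ s, a i * ξ i ω| ≤ ∑ i ∈ s, a i := fun ω => by
    rw [abs_of_nonneg (sum_nonneg fun i hi => mul_nonneg (ha i hi) (hξ0 i hi ω))]
    exact sum_le_sum fun i hi => by
      have := mul_le_mul_of_nonneg_left (hξ1 i hi ω) (ha i hi)
      simpa using this
  have hmeas : Measurable fun ω => ∑ i ∈ s, a i * ξ i ω :=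
    Finset.measurable_sum _ fun i hi => (hξm i hi).const_mul _
  have hI2 : Integrable (fun ω => (∑ i ∈ s, a i * ξ i ω) ^ 2) μ :=
    integrable_sq_of_ae_abs_le hmeas.aestronglyMeasurable (ae_of_all μ hbd)
  calc ∫ ω, (∑ i ∈ s, c i ω * ξ i ω) ^ 2 ∂μ ≤ ∫ ω, (∑ i ∈ s, a i * ξ i ω) ^ 2 ∂μ :=
        integral_mono_of_nonneg (ae_of_all μ fun ω => sq_nonneg _) hI2 (ae_of_all μ hpt)
    _ ≤ (∑ i ∈ s, a i * q i) ^ 2 + ∑ i ∈ s, a i ^ 2 * q i :=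
        integral_sq_sum_le_of_dominated s hξm hξ0 hξ1 ha h1 h2

/-- **THE TWO BRANCHES, IN WORDS OF THE COUNT** (uniform weights): with `a i = α` and `q i = q̄` for all `i ∈ s`,
`#s = N`: `∫ (Σ_i c i ξ i)² ≤ α²·((N q̄)² + N q̄)` — the coherent branch `(N q̄)²` dominates iff the expected count
`N q̄ ≥ 1`. [folklore] -/
theorem integral_sq_sum_le_of_dominated_uniform [IsFiniteMeasure μ] (s : Finset ι) {ξ c : ι → Ω → ℝ} {α qbar : ℝ}
    (hξm : ∀ i ∈ s, Measurable (ξ i)) (hξ0 : ∀ i ∈ s, ∀ ω, 0 ≤ ξ i ω) (hξ1 : ∀ i ∈ s, ∀ ω, ξ i ω ≤ 1)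
    (hα : 0 ≤ α) (hca : ∀ i ∈ s, ∀ ω, |c i ω| ≤ α)
    (h1 : ∀ i ∈ s, ∫ ω, ξ i ω ∂μ ≤ qbar)
    (h2 : ∀ i ∈ s, ∀ j ∈ s, i ≠ j → ∫ ω, ξ i ω * ξ j ω ∂μ ≤ qbar * qbar) :
    ∫ ω, (∑ i ∈ s, c i ω * ξ i ω) ^ 2 ∂μ ≤ α ^ 2 * ((s.card * qbar) ^ 2 + s.card * qbar) := by
  have h := integral_sq_sum_le_of_dominated_random s (a := fun _ => α) (q := fun _ => qbar) hξm hξ0 hξ1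
    (fun _ _ => hα) hca h1 h2
  simp only [sum_const, nsmul_eq_mul] at h
  calc ∫ ω, (∑ i ∈ s, c i ω * ξ i ω) ^ 2 ∂μ ≤ (s.card * (α * qbar)) ^ 2 + s.card * (α ^ 2 * qbar) := h
    _ = α ^ 2 * ((s.card * qbar) ^ 2 + s.card * qbar) := by ring

end Random

end Summit.QuantumFields.BalabanUV.T4Continuum.NE7LawLevel

end
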